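/-
Copyright: the b2b-balaban T⁴-continuum CRUX team, row NE7b leaf lineage `t4-ne7b-formalise-leaf-02` (gen 134). Project licence.
-/
import Summits.QuantumFields.BalabanUV.T4Continuum.Spine.NE7b.SineTentFloor
import Summits.QuantumFields.BalabanUV.T4Continuum.Spine.NE7b.CurlTermsLinear
import Summits.QuantumFields.BalabanUV.T4Continuum.Spine.NE7b.PlaquetteTermDisplacement
import Summits.QuantumFields.BalabanUV.T4Continuum.Spine.NE7b.AveragedCurlFormSplit

/-!
# THE CURL-ONLY (h2) FLOOR AT k = 1 WITH EVERY BOOKKEEPING INPUT DISCHARGED: for the curl form `F(B) = Σ_P X_P(B)²` of the unit torus (CCTL's shape, transports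
# `w` a parameter) and the sine-tent quadratic partition, `((c_loc − (1+t⁻¹)·2^d·(π∕(2L))²·4·2(d−1))∕(1+t))·Σ_c‖B c‖² ≤ Σ_P X_P(B)²` on `good` — what stays displayed is
# ONLY the local floor `c_loc` of the localised fields on `good` (Lemma 5.5's content) (row NE7b, node U5c; residual (R2′) family (2), letter (ℓ1); capstone junction)

Cell `pub-balaban`, sub-cell `t4`, spine estimate NE7b (`T4WeightBudget.RelWeightBound`; the cell's OWN estimate — NOT PRINTED in [Bałaban 1983–89],
NOT PROVED).  Crux-route work under `Spine/NE7b/`; NOTHING of Bałaban's estimates is asserted; no `def`; zero `sorry`; no `T4Continuum/Support` leaf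
(FREEZE (0)).  Imports BY NAME: this lineage's `…SineTentFloor` (STF: `ims_floor_of_sine_tent_partition_unit`), `…CurlTermsLinear` (CTL: `norm_curlMap_le`,
`sum_sq_norm_curlMaps_eq`), `…PlaquetteTermDisplacement` (PTD: `exists_unit_plaquetteBonds`), `…AveragedCurlFormSplit` (ACFS: `card_image_four_le`) and
`…TorusPlaquetteIncidence` (TPI: `card_plaquettes_through_bond_le`).

WHAT IS PROVED ([folklore]): **`ims_floor_curl_only`** — on the unit torus `(ℤ∕N)^d`, `N = M·L` (`M ≥ 2` cubes of side `L` per axis, offset `c₀`), for the curl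
terms `T_P B = Σ_{c∈bonds(P)} R_{P,c}(B c)` (CTL's maps by position, transports `w_i ∈ U1`), the curl functional `X` of CCTL's shape, and the sine-tent cutoffs
`h_S`: if the localised fields obey the local floor `c_loc·Σ_c‖h_S(c)B(c)‖² ≤ Σ_P ‖T_P(h_S B)‖²` on `good`, then
`((c_loc − (1+t⁻¹)·2^d·1²·(π∕(2L))²·4·(2(d−1)))∕(1+t))·Σ_c‖B c‖² ≤ Σ_P X_P(B)²` for `good B` — STF `_unit` with `inc := image ∘ ι` (`a = 4` ACFS, `b = 2(d−1)` TPI),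
`R`∕`ℓ = 1` (CTL), `pt := Prod.fst`, `hunit` (PTD), `F := Σ_P X_P²` (`hF` by CTL's identity).  By value (d = 4): `E·L² = 16·(π²∕4)·24 ≈ 947`.

NOT HERE (honest): the local floor `c_loc` itself (SectE-interface-proof Lemma 5.5: covariant Lemma 2.4′ per cube — the per-cube gauge letters CCTL (ℓ1) ∕ LGTS τ ∕
AFI ∕ AFC and the currency question Q-leaf05-g157-1), the average terms of `F^{full}`, `good`; anything of Bałaban's estimates.
BY-NAME EFFECT ON THE WALL: NONE.  NE7b NOT PRINTED ∕ NOT PROVED; spine PROVED 0∕9; rung (B)+1 on ONE finite T⁴ — NOT infinite volume, NOT the mass gap, NOT Clay.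
HONEST DEPENDENCY: continuum YM on T⁴ ⇐ BetaPertH ∧ nine spine estimates (0/9 proved); BetaPertH ⇐ (D1) ∧ (D4) ∧ CAP+tail; G-an2-4 gates asym, D1 and NE2/3/4.
-/

set_option autoImplicit false

noncomputable section

open Finset
open Literature.MathematicalPhysics.QuantumFieldTheory.Balaban1983to89.B14.TentUnityTorus (tentZ)
open Literature.MathematicalPhysics.QuantumFieldTheory.Balaban1983to89.B7Prop1Explicit (U1)
open Literature.MathematicalPhysics.QuantumFieldTheory.Balaban1983to89.B7Eq78Linearization (conjR conjR_add conjR_smul_real)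
open Summit.QuantumFields.BalabanUV.T4Continuum.NE7b.SineTentFloor (ims_floor_of_sine_tent_partition_unit)
open Summit.QuantumFields.BalabanUV.T4Continuum.NE7b.CurlTermsLinear (norm_curlMap_le sum_sq_norm_curlMaps_eq)
open Summit.QuantumFields.BalabanUV.T4Continuum.NE7b.PlaquetteTermDisplacement (exists_unit_plaquetteBonds)
open Summit.QuantumFields.BalabanUV.T4Continuum.NE7b.AveragedCurlFormSplit (card_image_four_le)
open Summit.QuantumFields.BalabanUV.T4Continuum.NE7b.TorusPlaquetteIncidence (card_plaquettes_through_bond_le)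

namespace Summit.QuantumFields.BalabanUV.T4Continuum.NE7b.CurlOnlySineFloor

variable {d : ℕ}
variable {𝔸 : Type*} [NormedRing 𝔸] [NormedAlgebra ℂ 𝔸] [NormOneClass 𝔸]

/-- **THE CURL-ONLY (h2) FLOOR AT k = 1, EVERY BOOKKEEPING INPUT DISCHARGED** (see the module docstring; STF `ims_floor_of_sine_tent_partition_unit` with the curl
terms' data from CTL ∕ PTD ∕ ACFS ∕ TPI).  Displayed: the local floor `c_loc` on `good`. [folklore] -/
theorem ims_floor_curl_only (L M N : ℕ) [NeZero M] [NeZero N] [Fact (1 < N)] (hL : 0 < L) (hM : 2 ≤ M) (hN : N = M * L) (c₀ : ℕ)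
    (ι : (Fin d → ZMod N) × {a : Fin d × Fin d // a.1 < a.2} → Fin 4 → (Fin d → ZMod N) × Fin d)
    (hι : ∀ x a, ι (x, a) = ![(x, a.1.1), (x + Pi.single a.1.1 1, a.1.2), (x + Pi.single a.1.2 1, a.1.1), (x, a.1.2)])
    (w : (Fin d → ZMod N) × {a : Fin d × Fin d // a.1 < a.2} → Fin 3 → 𝔸ˣ) (hw : ∀ P i, w P i ∈ U1 𝔸)
    (R : (Fin d → ZMod N) × {a : Fin d × Fin d // a.1 < a.2} → (Fin d → ZMod N) × Fin d → 𝔸 →ₗ[ℝ] 𝔸)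
    (hR : ∀ P c, R P c =
        if c = ι P 0 then LinearMap.id
        else if c = ι P 1 then LinearMap.mk ⟨conjR (w P 0), conjR_add (w P 0)⟩ (conjR_smul_real (w P 0))
        else if c = ι P 2 then -LinearMap.mk ⟨conjR (w P 1), conjR_add (w P 1)⟩ (conjR_smul_real (w P 1))
        else if c = ι P 3 then -LinearMap.mk ⟨conjR (w P 2), conjR_add (w P 2)⟩ (conjR_smul_real (w P 2))
        else 0)
    (X : (Fin d → ZMod N) × {a : Fin d × Fin d // a.1 < a.2} → ((Fin d → ZMod N) → Fin d → 𝔸) → ℝ)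
    (hX : ∀ (y : Fin d → ZMod N) (a : {a : Fin d × Fin d // a.1 < a.2}) (B : (Fin d → ZMod N) → Fin d → 𝔸), X (y, a) B =
      ‖B y a.1.1 + conjR (w (y, a) 0) (B (y + Pi.single a.1.1 1) a.1.2) - conjR (w (y, a) 1) (B (y + Pi.single a.1.2 1) a.1.1)
        - conjR (w (y, a) 2) (B y a.1.2)‖)
    (good : ((Fin d → ZMod N) × Fin d → 𝔸) → Prop) {cloc : ℝ}
    (hloc : ∀ (S : Fin d → ZMod M) (x : (Fin d → ZMod N) × Fin d → 𝔸), good x →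
      cloc * ∑ c, ‖(∏ ν, Real.sin (Real.pi / 2 * tentZ (L : ℝ) (c.1 ν - (((S ν).val * L + c₀ : ℕ) : ZMod N)))) • x c‖ ^ 2
        ≤ ∑ P, ‖∑ c ∈ Finset.univ.image (ι P),
            R P c ((∏ ν, Real.sin (Real.pi / 2 * tentZ (L : ℝ) (c.1 ν - (((S ν).val * L + c₀ : ℕ) : ZMod N)))) • x c)‖ ^ 2)
    {t : ℝ} (ht : 0 < t) (x : (Fin d → ZMod N) × Fin d → 𝔸) (hx : good x) :
    (cloc - (1 + t⁻¹) * ((((2 ^ Fintype.card (Fin d) : ℕ)) : ℝ) * (1 : ℝ) ^ 2 * (Real.pi / (2 * L)) ^ 2 * (4 : ℕ) * (2 * (d - 1) : ℕ))) / (1 + t)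
        * ∑ c, ‖x c‖ ^ 2 ≤ ∑ P, X P (fun y μ => x (y, μ)) ^ 2 := by
  classical
  have hF : ∀ z : (Fin d → ZMod N) × Fin d → 𝔸, good z →
      ∑ P, ‖∑ c ∈ Finset.univ.image (ι P), R P c (z c)‖ ^ 2 ≤ ∑ P, X P (fun y μ => z (y, μ)) ^ 2 :=
    fun z _ => le_of_eq (sum_sq_norm_curlMaps_eq ι hι w R hR X hX (fun y μ => z (y, μ)))
  exact ims_floor_of_sine_tent_partition_unit (A := Fin d) L M N hL hM hN c₀
    (fun P => Finset.univ.image (ι P)) R (ℓ := 1) (fun P c v => norm_curlMap_le ι w hw R hR P c v)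
    Prod.fst (fun P => ι P 0) (exists_unit_plaquetteBonds ι hι)
    (a := 4) (b := 2 * (d - 1)) (fun P => card_image_four_le (ι P)) (fun c => card_plaquettes_through_bond_le ι hι c)
    good hloc (fun z => ∑ P, X P (fun y μ => z (y, μ)) ^ 2) hF ht x hx

end Summit.QuantumFields.BalabanUV.T4Continuum.NE7b.CurlOnlySineFloor

end
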